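import Summits.CriticalPhenomena.PercolationContinuityZ3.Theorems.PercNearOneGluingNoHeavyLowerTailQuantitativeGenZeroSet
import HarnessLib

/-!
# The explicit GEN FLOOR is COMPLETE: `0 < Sur_o(A)` iff the floor is positive at some compatible rank (the (GEN) analogue of row M2-R41)

Support file (`--supports stmt-CriticalPhenomena-4575`), prover seat `prim-rate-mine-2` (lane prim-rate, constants-miner (c), BENCH row
M2-R43 (vi); `run/shared/lean/prim/prim-rate/prim-rate-mine-2/PROOFS.md` §P44 (vi)).  No definitions, no named facts, no sorries; standard axioms.

Rows M2-R4 / M2-R13 bounded the master form (GEN) below by `Σ_a γ_a φ_a` (+ world floors); row M2-R41 proved that the explicit, size-free (S5) floor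
`FLOOR_F(r; T, o, v)` (rank gains × detachment constants + isolated Harris terms) is COMPLETE.  By the GEN peeling identity (`CSH.surplus_peel_top`) the
explicit GEN floor at a compatible injective rank `r'` of `T = A ∖ k` (`k` the top relay) is
  `GENFLOOR_F(r') := FLOOR_F(r'; T, o, k) + γ_k·φ_k + ∏_{e ∩ T ≠ ∅}(1 − w_e)·Cov_{w_T}(F(C_k), 1{k ↔ o})`
(`φ_k = avoidConst w k T o = μ(o ∈ C_k ∣ k ↮ T)`, Kozma–Nitzan's detachment constant; `w_T` = the weights zeroed on the pairs meeting `T` — the isolated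
Harris term of the top relay at a blind second observer; `FLOOR_F` VERBATIM the floor of `CSH.s5dMargin_ge_sum_rankGain_add_isolatedFloor_of_lt_one_of_compat`).
* `CSH.isolatedCov_top_pos_iff` — the top relay's isolated Harris term is positive iff a pair of `E` missing `T` is jointly pivotal inside the pairs of
  `E` missing `T` (row M2-R44 `QuantBHK.condCov_clusterFun_openConn_pos_iff` read at the weights `w_T`, whose support is `E_T`, with `X = ∅`);
* `CSH.surplus_pos_iff_exists_compat_rank_genFloor_pos` — **preconnected non-degenerate support, `|A| ≥ 2`, `o ∉ A`, `F` monotone `≥ 0`, `r` injective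
  compatible with top relay `k`:  `0 < surplus w A r F o ↔ ∃ r'` injective compatible on `T` with `0 < GENFLOOR_F(r')`** (`CSH.surplus_pos_iff_certificates`
  + the three summands are nonnegative, and positive exactly under certificates (C1), (C2), (C3) respectively).
[cite: KozmaNitzan2024, Conj. 4 (p. 32), Lemma 2 (p. 6)] [cite: VandenbergHaggstromKahn2005, Thm. 1.3 (p. 6)] [cite: Harris1960, Lemma 4.1 (p. 16)]
-/

noncomputable section

namespace Summit.CriticalPhenomena.PercolationContinuityZ3.Theorems

open MeasureTheory Set Literature.Probability.LatticeModels Literature.Probability.Percolation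
open scoped Classical
open KNPreFKG

namespace CSH

variable {n : ℕ}

/-- **The isolated Harris term of the top relay is positive iff certificate (C3) holds** (row M2-R44 at the weights zeroed on the pairs meeting
`T = A ∖ k`, `X = ∅`): weights non-degenerate on `E`, `k ∈ A`, `o ∉ A`, `F` monotone. [cite: VandenbergHaggstromKahn2005, Thm. 1.3 (p. 6)] [cite: Harris1960, Lemma 4.1 (p. 16)] -/
theorem isolatedCov_top_pos_iff (w : Sym2 (Fin n) → unitInterval) (E : Set (Sym2 (Fin n)))
    (hE0 : ∀ f, f ∉ E → (w f : ℝ) = 0) (hE1 : ∀ f ∈ E, 0 < (w f : ℝ) ∧ (w f : ℝ) < 1)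
    (A : Finset (Fin n)) (k o : Fin n) (hkA : k ∈ A) (hoA : o ∉ A)
    (F : Set (Fin n) → ℝ) (hF : ∀ S S' : Set (Fin n), S ⊆ S' → F S ≤ F S') :
    0 < ((∫ η in openConn k o, F {c | c = k ∨ ∃ e ∈ openEdgeCluster η k, c ∈ e} ∂(prodBernoulli (fun e => if (∃ y ∈ (↑(A.erase k) : Set (Fin n)), y ∈ e) then (0 : unitInterval) else w e))) -
              (prodBernoulli (fun e => if (∃ y ∈ (↑(A.erase k) : Set (Fin n)), y ∈ e) then (0 : unitInterval) else w e)).real (openConn k o) *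
                ∫ η, F {c | c = k ∨ ∃ e ∈ openEdgeCluster η k, c ∈ e} ∂(prodBernoulli (fun e => if (∃ y ∈ (↑(A.erase k) : Set (Fin n)), y ∈ e) then (0 : unitInterval) else w e))) ↔
      ∃ e ∈ E, (∀ y ∈ (↑(A.erase k) : Set (Fin n)), y ∉ e) ∧ ∃ η : Set (Sym2 (Fin n)), η ⊆ {f | f ∈ E ∧ ∀ y ∈ (↑(A.erase k) : Set (Fin n)), y ∉ f} ∧
          F (openCluster (η \ {e}) k) < F (openCluster (insert e η) k) ∧
          insert e η ∈ (openConn k o : Set (BondConfig (Fin n))) ∧ η \ {e} ∉ (openConn k o : Set (BondConfig (Fin n))) := by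
  set wT : Sym2 (Fin n) → unitInterval := (fun e => if (∃ y ∈ (↑(A.erase k) : Set (Fin n)), y ∈ e) then (0 : unitInterval) else w e) with hwT
  set ET : Set (Sym2 (Fin n)) := {f | f ∈ E ∧ ∀ y ∈ (↑(A.erase k) : Set (Fin n)), y ∉ f} with hET
  have hok : o ≠ k := fun h => hoA (h ▸ hkA)
  have hE0' : ∀ f, f ∉ ET → (wT f : ℝ) = 0 := by
    intro f hf
    simp only [hwT]
    split_ifs with h
    · rfl
    · exact hE0 f fun hfE => hf ⟨hfE, fun y hy hyf => h ⟨y, hy, hyf⟩⟩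
  have hE1' : ∀ f ∈ ET, 0 < (wT f : ℝ) ∧ (wT f : ℝ) < 1 := by
    intro f hf
    have h : ¬ ∃ y ∈ (↑(A.erase k) : Set (Fin n)), y ∈ f := fun ⟨y, hy, hyf⟩ => hf.2 y hy hyf
    simp only [hwT, if_neg h]
    exact hE1 f hf.1
  have hB := QuantBHK.condCov_clusterFun_openConn_pos_iff wT ET hE0' hE1' k (∅ : Set (Fin n)) o (Set.notMem_empty k) hok
    (Set.notMem_empty o) F hF
  have hD : {ω : BondConfig (Fin n) | ∀ y ∈ (∅ : Set (Fin n)), ¬ (openGraph ω).Reachable k y} = univ := by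
    ext ω; simp
  have hfx : ∀ ζ : BondConfig (Fin n), F {c | c = k ∨ ∃ e ∈ openEdgeCluster ζ k, c ∈ e} = F (openCluster ζ k) := by
    intro ζ; rw [KNPreFKG.openCluster_eq_setOf_openEdgeCluster]
  rw [hD, probReal_univ, one_mul, univ_inter, Measure.restrict_univ] at hB
  simp only [hfx]
  rw [show (prodBernoulli wT).real (openConn k o) * ∫ η, F (openCluster η k) ∂(prodBernoulli wT) =
      (∫ η, F (openCluster η k) ∂(prodBernoulli wT)) * (prodBernoulli wT).real (openConn k o) from mul_comm _ _, hB]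
  constructor
  · rintro ⟨e, he, -, η, hη, h⟩
    exact ⟨e, he.1, he.2, η, fun f hf => (hη hf).1, h⟩
  · rintro ⟨e, he, heT, η, hη, h⟩
    exact ⟨e, ⟨he, heT⟩, fun y hy => hy.elim, η, fun f hf => ⟨hη hf, fun y hy => hy.elim⟩, h⟩

/-- **Completeness of the explicit GEN floor** (preconnected non-degenerate support, `|A| ≥ 2`, compatible injective rank with top relay `k`, `o ∉ A`,
`F` monotone `≥ 0`): `0 < Sur_o(A)` iff `GENFLOOR_F(r') > 0` at some compatible injective rank `r'` of `A ∖ k`.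
[cite: KozmaNitzan2024, Conj. 4 (p. 32)] [cite: VandenbergHaggstromKahn2005, Thm. 1.3 (p. 6)] [cite: Harris1960, Lemma 4.1 (p. 16)] -/
theorem surplus_pos_iff_exists_compat_rank_genFloor_pos (w : Sym2 (Fin n) → unitInterval) (E : Set (Sym2 (Fin n)))
    (hE0 : ∀ f, f ∉ E → (w f : ℝ) = 0) (hE1 : ∀ f ∈ E, 0 < (w f : ℝ) ∧ (w f : ℝ) < 1)
    (A : Finset (Fin n)) (r : Fin n → ℕ) (hr : Set.InjOn r ↑A) (k : Fin n) (hkA : k ∈ A) (hkmax : ∀ a ∈ A, r a ≤ r k)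
    (o : Fin n) (hoA : o ∉ A)
    (F : Set (Fin n) → ℝ) (hF : ∀ S S' : Set (Fin n), S ⊆ S' → F S ≤ F S') (hF0 : ∀ S : Set (Fin n), 0 ≤ F S)
    (hcompat : ∀ a ∈ A, ∀ a' ∈ A, r a < r a' →
      ∫ ω, F (openCluster ω a) ∂(prodBernoulli w) ≤ ∫ ω, F (openCluster ω a') ∂(prodBernoulli w))
    (hconn : (openGraph E).Preconnected) (hT : (A.erase k).Nonempty) :
    0 < surplus w A r F o ↔
      ∃ r' : Fin n → ℕ, Set.InjOn r' ↑(A.erase k) ∧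
        (∀ a ∈ (A.erase k), ∀ a' ∈ (A.erase k), r' a < r' a' →
        ∫ ω, F (openCluster ω a) ∂(prodBernoulli w) ≤ ∫ ω, F (openCluster ω a') ∂(prodBernoulli w)) ∧
        0 < ∑ a ∈ (A.erase k), (rankGain w (A.erase k) r' F a * avoidConst w a ((↑(((A.erase k)).erase a) : Set (Fin n)) ∪ ({d | d ∈ ([] : List (Fin n))} ∪ {k})) o +
        (∏ e ∈ Finset.univ.filter (fun e : Sym2 (Fin n) => ∃ y ∈ (↑(((A.erase k)).filter (fun b => r' b < r' a)) : Set (Fin n)), y ∈ e), (1 - (w e : ℝ))) *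
          ((∫ η in ((⋃ t ∈ (insert a (((A.erase k)).filter (fun b => r' a < r' b) ∪ (([] : List (Fin n))).toFinset)), openConn o t) ∪ openConn o k),
              F {c | c = a ∨ ∃ e ∈ openEdgeCluster η a, c ∈ e}
              ∂(prodBernoulli fun e => if (∃ y ∈ (↑(((A.erase k)).filter (fun b => r' b < r' a)) : Set (Fin n)), y ∈ e) then (0 : unitInterval) else w e)) -
            (prodBernoulli fun e => if (∃ y ∈ (↑(((A.erase k)).filter (fun b => r' b < r' a)) : Set (Fin n)), y ∈ e) then (0 : unitInterval) else w e).real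
                ((⋃ t ∈ (insert a (((A.erase k)).filter (fun b => r' a < r' b) ∪ (([] : List (Fin n))).toFinset)), openConn o t) ∪ openConn o k) *
              (∫ η, F {c | c = a ∨ ∃ e ∈ openEdgeCluster η a, c ∈ e}
                ∂(prodBernoulli fun e => if (∃ y ∈ (↑(((A.erase k)).filter (fun b => r' b < r' a)) : Set (Fin n)), y ∈ e) then (0 : unitInterval) else w e)))) +
          rankGain w A r F k * avoidConst w k (↑(A.erase k) : Set (Fin n)) o +
          (∏ e ∈ Finset.univ.filter (fun e : Sym2 (Fin n) => ∃ y ∈ (↑(A.erase k) : Set (Fin n)), y ∈ e), (1 - (w e : ℝ))) *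
            ((∫ η in openConn k o, F {c | c = k ∨ ∃ e ∈ openEdgeCluster η k, c ∈ e} ∂(prodBernoulli (fun e => if (∃ y ∈ (↑(A.erase k) : Set (Fin n)), y ∈ e) then (0 : unitInterval) else w e))) -
              (prodBernoulli (fun e => if (∃ y ∈ (↑(A.erase k) : Set (Fin n)), y ∈ e) then (0 : unitInterval) else w e)).real (openConn k o) *
                ∫ η, F {c | c = k ∨ ∃ e ∈ openEdgeCluster η k, c ∈ e} ∂(prodBernoulli (fun e => if (∃ y ∈ (↑(A.erase k) : Set (Fin n)), y ∈ e) then (0 : unitInterval) else w e))) := by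
  have hw : ∀ e, w e < 1 := by
    intro e
    by_cases he : e ∈ E
    · exact_mod_cast (hE1 e he).2
    · have h0 := hE0 e he
      exact_mod_cast (show (w e : ℝ) < 1 by rw [h0]; norm_num)
  set T : Finset (Fin n) := A.erase k with hT'
  have hTA : ∀ a ∈ T, a ∈ A := fun a ha => Finset.mem_of_mem_erase ha
  have hkT : k ∉ T := Finset.notMem_erase k A
  have hoT : o ∉ T := fun h => hoA (hTA o h)
  have hok : o ≠ k := fun h => hoA (h ▸ hkA)
  have hrT : Set.InjOn r ↑T := hr.mono (by intro a ha; exact Finset.mem_of_mem_erase ha)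
  have hcompatT : (∀ a ∈ T, ∀ a' ∈ T, r a < r a' →
        ∫ ω, F (openCluster ω a) ∂(prodBernoulli w) ≤ ∫ ω, F (openCluster ω a') ∂(prodBernoulli w)) := fun a ha a' ha' h => hcompat a (hTA a ha) a' (hTA a' ha') h
  have hcert := surplus_pos_iff_certificates w E hE0 hE1 A r hr k hkA hkmax o hoA F hF hF0 hcompat hconn hT
  have hiso := isolatedCov_top_pos_iff w E hE0 hE1 A k o hkA hoA F hF
  -- nonnegativity of the three summands
  have hfl0 : ∀ r' : Fin n → ℕ, (∀ a ∈ T, ∀ a' ∈ T, r' a < r' a' →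
        ∫ ω, F (openCluster ω a) ∂(prodBernoulli w) ≤ ∫ ω, F (openCluster ω a') ∂(prodBernoulli w)) → 0 ≤ ∑ a ∈ T, (rankGain w T r' F a * avoidConst w a ((↑((T).erase a) : Set (Fin n)) ∪ ({d | d ∈ ([] : List (Fin n))} ∪ {k})) o +
        (∏ e ∈ Finset.univ.filter (fun e : Sym2 (Fin n) => ∃ y ∈ (↑((T).filter (fun b => r' b < r' a)) : Set (Fin n)), y ∈ e), (1 - (w e : ℝ))) *
          ((∫ η in ((⋃ t ∈ (insert a ((T).filter (fun b => r' a < r' b) ∪ (([] : List (Fin n))).toFinset)), openConn o t) ∪ openConn o k),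
              F {c | c = a ∨ ∃ e ∈ openEdgeCluster η a, c ∈ e}
              ∂(prodBernoulli fun e => if (∃ y ∈ (↑((T).filter (fun b => r' b < r' a)) : Set (Fin n)), y ∈ e) then (0 : unitInterval) else w e)) -
            (prodBernoulli fun e => if (∃ y ∈ (↑((T).filter (fun b => r' b < r' a)) : Set (Fin n)), y ∈ e) then (0 : unitInterval) else w e).real
                ((⋃ t ∈ (insert a ((T).filter (fun b => r' a < r' b) ∪ (([] : List (Fin n))).toFinset)), openConn o t) ∪ openConn o k) *
              (∫ η, F {c | c = a ∨ ∃ e ∈ openEdgeCluster η a, c ∈ e}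
                ∂(prodBernoulli fun e => if (∃ y ∈ (↑((T).filter (fun b => r' b < r' a)) : Set (Fin n)), y ∈ e) then (0 : unitInterval) else w e)))) := by
    intro r' hc'
    have hnn := fun a (ha : a ∈ T) => isolatedFloor_term_nonneg w o k T r' F hF hF0 hc' a ha
    exact Finset.sum_nonneg fun a ha => add_nonneg (hnn a ha).1 (hnn a ha).2
  have hDpos : 0 < (prodBernoulli w).real {ω : BondConfig (Fin n) | ∀ a ∈ (↑(A.erase k) : Set (Fin n)), ¬ (openGraph ω).Reachable k a} := by
    refine prodBernoulli_real_pos_of_empty_mem w hw ?_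
    intro a ha h
    rw [HullPort.reachable_empty_iff] at h
    subst h
    exact hkT (Finset.mem_coe.1 ha)
  have hφ : avoidConst w k (↑T : Set (Fin n)) o = (prodBernoulli w).real ({ω : BondConfig (Fin n) | ∀ a ∈ (↑(A.erase k) : Set (Fin n)), ¬ (openGraph ω).Reachable k a} ∩ openConn o k) / (prodBernoulli w).real {ω : BondConfig (Fin n) | ∀ a ∈ (↑(A.erase k) : Set (Fin n)), ¬ (openGraph ω).Reachable k a} := by
    rw [avoidConst, openConn_symm o k]
  have hφ0 : 0 ≤ avoidConst w k (↑T : Set (Fin n)) o := by rw [hφ]; exact div_nonneg measureReal_nonneg measureReal_nonneg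
  have hγ0 : 0 ≤ rankGain w A r F k := rankGain_nonneg w A r F k fun a' ha' hlt => hcompat a' ha' k hkA hlt
  have hprod : 0 < (∏ e ∈ Finset.univ.filter (fun e : Sym2 (Fin n) => ∃ y ∈ (↑(A.erase k) : Set (Fin n)), y ∈ e), (1 - (w e : ℝ))) := by
    refine Finset.prod_pos fun e _ => ?_
    have : (w e : ℝ) < 1 := by exact_mod_cast hw e
    linarith
  have hiso0 : 0 ≤ ((∫ η in openConn k o, F {c | c = k ∨ ∃ e ∈ openEdgeCluster η k, c ∈ e} ∂(prodBernoulli (fun e => if (∃ y ∈ (↑(A.erase k) : Set (Fin n)), y ∈ e) then (0 : unitInterval) else w e))) -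
              (prodBernoulli (fun e => if (∃ y ∈ (↑(A.erase k) : Set (Fin n)), y ∈ e) then (0 : unitInterval) else w e)).real (openConn k o) *
                ∫ η, F {c | c = k ∨ ∃ e ∈ openEdgeCluster η k, c ∈ e} ∂(prodBernoulli (fun e => if (∃ y ∈ (↑(A.erase k) : Set (Fin n)), y ∈ e) then (0 : unitInterval) else w e))) := by
    rcases lt_or_ge 0 ((∫ η in openConn k o, F {c | c = k ∨ ∃ e ∈ openEdgeCluster η k, c ∈ e} ∂(prodBernoulli (fun e => if (∃ y ∈ (↑(A.erase k) : Set (Fin n)), y ∈ e) then (0 : unitInterval) else w e))) -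
              (prodBernoulli (fun e => if (∃ y ∈ (↑(A.erase k) : Set (Fin n)), y ∈ e) then (0 : unitInterval) else w e)).real (openConn k o) *
                ∫ η, F {c | c = k ∨ ∃ e ∈ openEdgeCluster η k, c ∈ e} ∂(prodBernoulli (fun e => if (∃ y ∈ (↑(A.erase k) : Set (Fin n)), y ∈ e) then (0 : unitInterval) else w e))) with h | h
    · exact h.le
    · -- Harris at the zeroed weights: the covariance of two monotone functions is nonnegative
      have hmono : Monotone (fun C : Set (Sym2 (Fin n)) => F {c | c = k ∨ ∃ e ∈ C, c ∈ e}) := by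
        intro C C' hCC'
        refine hF _ _ fun c hc => ?_
        rcases hc with hc | ⟨e, he, hce⟩
        · exact Or.inl hc
        · exact Or.inr ⟨e, hCC' he, hce⟩
      have hc := Consts.covD_conn_nonneg (fun e => if (∃ y ∈ (↑(A.erase k) : Set (Fin n)), y ∈ e) then (0 : unitInterval) else w e) k (∅ : Set (Fin n)) (Set.notMem_empty k)
        (fun C : Set (Sym2 (Fin n)) => F {c | c = k ∨ ∃ e ∈ C, c ∈ e}) hmono o
      have hD : {ω : BondConfig (Fin n) | ∀ y ∈ (∅ : Set (Fin n)), ¬ (openGraph ω).Reachable k y} = univ := by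
        ext ω; simp
      rw [covD, hD, probReal_univ, one_mul, univ_inter, Measure.restrict_univ] at hc
      linarith
  constructor
  · intro hpos
    rcases hcert.1 hpos with ⟨r', hr', hc', hfl⟩ | ⟨hP, hγ⟩ | hC3
    · refine ⟨r', hr', hc', ?_⟩
      nlinarith [mul_nonneg hγ0 hφ0, mul_nonneg hprod.le hiso0]
    · refine ⟨r, hrT, hcompatT, ?_⟩
      have hφpos : 0 < avoidConst w k (↑T : Set (Fin n)) o := by rw [hφ]; exact div_pos hP hDpos
      nlinarith [hfl0 r hcompatT, mul_pos hγ hφpos, mul_nonneg hprod.le hiso0]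
    · refine ⟨r, hrT, hcompatT, ?_⟩
      nlinarith [hfl0 r hcompatT, mul_nonneg hγ0 hφ0, mul_pos hprod (hiso.2 hC3)]
  · rintro ⟨r', hr', hc', hsum⟩
    apply hcert.2
    by_contra H
    push Not at H
    obtain ⟨H1, H2, H3⟩ := H
    have h1 : ∑ a ∈ T, (rankGain w T r' F a * avoidConst w a ((↑((T).erase a) : Set (Fin n)) ∪ ({d | d ∈ ([] : List (Fin n))} ∪ {k})) o +
        (∏ e ∈ Finset.univ.filter (fun e : Sym2 (Fin n) => ∃ y ∈ (↑((T).filter (fun b => r' b < r' a)) : Set (Fin n)), y ∈ e), (1 - (w e : ℝ))) *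
          ((∫ η in ((⋃ t ∈ (insert a ((T).filter (fun b => r' a < r' b) ∪ (([] : List (Fin n))).toFinset)), openConn o t) ∪ openConn o k),
              F {c | c = a ∨ ∃ e ∈ openEdgeCluster η a, c ∈ e}
              ∂(prodBernoulli fun e => if (∃ y ∈ (↑((T).filter (fun b => r' b < r' a)) : Set (Fin n)), y ∈ e) then (0 : unitInterval) else w e)) -
            (prodBernoulli fun e => if (∃ y ∈ (↑((T).filter (fun b => r' b < r' a)) : Set (Fin n)), y ∈ e) then (0 : unitInterval) else w e).real
                ((⋃ t ∈ (insert a ((T).filter (fun b => r' a < r' b) ∪ (([] : List (Fin n))).toFinset)), openConn o t) ∪ openConn o k) *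
              (∫ η, F {c | c = a ∨ ∃ e ∈ openEdgeCluster η a, c ∈ e}
                ∂(prodBernoulli fun e => if (∃ y ∈ (↑((T).filter (fun b => r' b < r' a)) : Set (Fin n)), y ∈ e) then (0 : unitInterval) else w e)))) ≤ 0 := by
      rcases (hfl0 r' hc').lt_or_eq with hlt | heq
      · exact absurd hlt (not_lt.2 (H1 r' hr' hc'))
      · exact heq.symm.le
    have h2 : rankGain w A r F k * avoidConst w k (↑T : Set (Fin n)) o ≤ 0 := by
      rcases hγ0.lt_or_eq with hγ | hγ
      · rcases hφ0.lt_or_eq with hφp | hφz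
        · have hP : 0 < (prodBernoulli w).real ({ω : BondConfig (Fin n) | ∀ a ∈ (↑(A.erase k) : Set (Fin n)), ¬ (openGraph ω).Reachable k a} ∩ openConn o k) := by
            rcases (measureReal_nonneg (μ := prodBernoulli w) (s := {ω : BondConfig (Fin n) | ∀ a ∈ (↑(A.erase k) : Set (Fin n)), ¬ (openGraph ω).Reachable k a} ∩ openConn o k)).lt_or_eq with h | h
            · exact h
            · exfalso
              rw [hφ, ← h, zero_div] at hφp
              exact lt_irrefl _ hφp
          exact absurd hγ (not_lt.2 (H2 hP))
        · rw [← hφz, mul_zero]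
      · rw [← hγ, zero_mul]
    have h3 : (∏ e ∈ Finset.univ.filter (fun e : Sym2 (Fin n) => ∃ y ∈ (↑(A.erase k) : Set (Fin n)), y ∈ e), (1 - (w e : ℝ))) * ((∫ η in openConn k o, F {c | c = k ∨ ∃ e ∈ openEdgeCluster η k, c ∈ e} ∂(prodBernoulli (fun e => if (∃ y ∈ (↑(A.erase k) : Set (Fin n)), y ∈ e) then (0 : unitInterval) else w e))) -
              (prodBernoulli (fun e => if (∃ y ∈ (↑(A.erase k) : Set (Fin n)), y ∈ e) then (0 : unitInterval) else w e)).real (openConn k o) *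
                ∫ η, F {c | c = k ∨ ∃ e ∈ openEdgeCluster η k, c ∈ e} ∂(prodBernoulli (fun e => if (∃ y ∈ (↑(A.erase k) : Set (Fin n)), y ∈ e) then (0 : unitInterval) else w e))) ≤ 0 := by
      rcases hiso0.lt_or_eq with hlt | heq
      · obtain ⟨e, he, heT, η, hη, hF', h1, h2'⟩ := hiso.1 hlt
        exact absurd (H3 e he heT η hη hF' h1) h2'
      · rw [← heq, mul_zero]
    linarith

end CSH

end Summit.CriticalPhenomena.PercolationContinuityZ3.Theorems

end
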